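import Literature.AlgebraicGeometry.Motives.FaltingsECTateFiniteHoldsProofs
import Literature.AlgebraicGeometry.Motives.FaltingsECIsogenyFiniteProofs
import Literature.AlgebraicGeometry.Motives.FaltingsECCardProofs
import Literature.NumberTheory.EllipticCurves.FrobeniusTateModuleProofs
import HarnessLib

/-!
# Tate's theorem for two elliptic curves over a finite field: the cases, and what remains

Sibling proof file (D-0014; theorems only) of `Literature.AlgebraicGeometry.Motives.FaltingsEC`
for its named fact

* `Literature.Hodge.mem_span_range_tateModule_map_of_equivariant_of_finite W W' ℓ` — **Tate, Invent.
  Math. 2 (1966), Main Theorem, for two elliptic curves `E, E'` over a finite field `k` and a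
  prime `ℓ ≠ char k`**: every `ℤ_ℓ`-linear `Γ_k`-equivariant map `T_ℓ E → T_ℓ E'` lies in the
  `ℤ_ℓ`-span of the maps `T_ℓ φ`, `φ : E → E'` an isogeny over `k` (surjectivity of
  `Hom_k(E, E') ⊗ ℤ_ℓ → Hom_{Γ_k}(T_ℓ E, T_ℓ E')`, Silverman, *AEC*, Thm. III.7.7(a)).

State of the tree. The fact is **proved** for `E' = E`
(`mem_span_range_tateModule_map_of_equivariant_of_finite_self`, file
`FaltingsECTateFiniteHoldsProofs`, resting on Tate's §1 Lemma 1 and §2 Propositions 1–2 for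
elliptic curves — `FaltingsECTateLemma1Proofs`, `FaltingsECRankTwoProofs`,
`FaltingsECRankTwoLimitProofs`, `FaltingsECTateProp1Proofs`, `FaltingsECTateMainTheoremProofs` —
and on the quotient isogenies and Cor. III.4.11 of *AEC*), hence for every pair of **isogenous**
curves (`…_of_isIsogenous`: push forward along one isogeny and saturate). This file records, with
proofs, how the general pair reduces to Tate's **isogeny theorem** (Theorem 1 of the paper), the
one input of the printed proof that lives on the abelian surface `E × E'` (Tate, §1 Lemma 3 and
§3, proof of Theorem 1: the Main Theorem for `End_k(E × E')`) and is not a theorem of the tree: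

* `…_iff_isogeny_theorem`: for each `(E, E', ℓ)` the named fact is **equivalent** to the
  corrected isogeny-theorem fact `isIsogenous_of_finite_iff_exists_tateModule_hom_ne_zero W W' ℓ`
  (Tate, Thm. 1 (b): `E ~_k E'` iff `Hom_Γ(T_ℓ E, T_ℓ E') ≠ 0`);
* `…_of_forall_eq_zero`, `…_of_trace_frobenius_ne`, `…_of_card_point_ne`: the **vacuous cases** —
  if the Frobenius traces on `T_ℓ E`, `T_ℓ E'` differ, in particular (Thm. V.2.3.1) if
  `#E(k) ≠ #E'(k)`, there is no non-zero equivariant `T_ℓ E → T_ℓ E'` and the fact holds with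
  nothing to prove (the determinants agree, both being `q`: `det_galoisRepTate_frobenius_holds`,
  from the Weil pairing proved in the tree);
* `…_of_card_point_form`, `…_iff_card_point_form`: hence the fact for `(E, E', ℓ)` follows from —
  and, given the trace of Frobenius (Thm. V.2.3.1, the named facts
  `trace_galoisRepTate_frobenius`), is equivalent to — the isogeny theorem in **point-count form**
  `isIsogenous_iff_card_point_eq W W'` (Tate, Thm. 1 (c): `#E(k) = #E'(k) ⇒ E ~_k E'`;
  *AEC* Exercise 5.4(b)).

So the pairs for which the named fact is not a theorem of the tree are exactly the pairs with
equal numbers of rational points not known to be isogenous; by Tate's Theorem 1 there are none,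
and its proof for such a pair needs `End_k(E × E')` (or Deuring's lifting), i.e. abelian surfaces —
see `FaltingsECOfAbelianVarietyLatticeProofs` for the reduction of Theorem 1 (b) to named facts of
the theory of abelian varieties.

## References

* [Tate1966Endomorphisms] J. Tate, *Endomorphisms of abelian varieties over finite fields*,
  Invent. Math. 2 (1966), 134–144: Main Theorem; §1 Lemma 3; §3 Theorem 1 (a)⇔(b)⇔(c).
* [SilvermanAEC2009] J. H. Silverman, *The Arithmetic of Elliptic Curves*, 2nd ed., GTM 106:
  Thm. III.7.7(a), Thm. V.2.3.1, Exercise 5.4.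
-/

noncomputable section

universe u

namespace Literature.AlgebraicGeometry.Motives

open WeierstrassCurve

variable {K : Type u} [Field K] (W W' : WeierstrassCurve K) (ℓ : ℕ) [Fact ℓ.Prime]

/-! ## What remains is exactly the isogeny theorem -/

/-- **Tate's Main Theorem for a pair of elliptic curves over a finite field is equivalent, given
the tree, to Tate's isogeny theorem for that pair.** For `E, E'` over a finite field `k` and a
prime `ℓ`, the named fact `mem_span_range_tateModule_map_of_equivariant_of_finite W W' ℓ`
(`Hom_k(E, E') ⊗ ℤ_ℓ → Hom_Γ(T_ℓ E, T_ℓ E')` onto) holds iff the corrected isogeny-theorem fact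
`isIsogenous_of_finite_iff_exists_tateModule_hom_ne_zero W W' ℓ` (`E ~_k E'` iff there is a
non-zero `Γ_k`-equivariant `T_ℓ E → T_ℓ E'`, for `ℓ ≠ char k`) holds: forward by
`isIsogenous_of_finite_iff_exists_tateModule_hom_ne_zero_of_tate` (a non-zero element of the span
forces an isogeny), backward by `…_of_isogenous_fact` (one isogeny `E → E'` and the proved case of
isogenous curves). Tate, Invent. Math. 2 (1966), Main Theorem and Theorem 1 (b).
[cite: Tate1966Endomorphisms, Main Theorem and Thm. 1(b)] -/
theorem mem_span_range_tateModule_map_of_equivariant_of_finite_iff_isogeny_theorem :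
    mem_span_range_tateModule_map_of_equivariant_of_finite W W' ℓ ↔
      isIsogenous_of_finite_iff_exists_tateModule_hom_ne_zero W W' ℓ :=
  ⟨isIsogenous_of_finite_iff_exists_tateModule_hom_ne_zero_of_tate W W' ℓ,
    mem_span_range_tateModule_map_of_equivariant_of_finite_of_isogenous_fact (W := W) (W' := W') ℓ⟩

/-! ## The vacuous cases -/

/-- **The vacuous case of Tate's theorem**: if every `Γ_k`-equivariant `ℤ_ℓ`-linear map
`T_ℓ E → T_ℓ E'` is zero (`Hom_Γ(T_ℓ E, T_ℓ E') = 0`), the named fact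
`mem_span_range_tateModule_map_of_equivariant_of_finite W W' ℓ` holds, `0` lying in every span.
[folklore] -/
theorem mem_span_range_tateModule_map_of_equivariant_of_finite_of_forall_eq_zero
    (h0 : ∀ [Finite K] [W.IsElliptic] [W'.IsElliptic], (ℓ : K) ≠ 0 →
      ∀ f : W.tateModule ℓ →ₗ[ℤ_[ℓ]] W'.tateModule ℓ,
        (∀ (σ : Field.absoluteGaloisGroup K) (x : W.tateModule ℓ), f (σ • x) = σ • f x) → f = 0) :
    mem_span_range_tateModule_map_of_equivariant_of_finite W W' ℓ := by
  intro _ _ _ hℓ f hf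
  rw [h0 hℓ f hf]
  exact Submodule.zero_mem _

/-- **Tate's theorem holds, vacuously, for two elliptic curves over a finite field whose Frobenius
traces on `T_ℓ` differ.** For `E, E'` elliptic over a finite field `k`, a prime `ℓ` and the
arithmetic Frobenius `σ_q ∈ Γ_k`, if `tr ρ_{E,ℓ}(σ_q) ≠ tr ρ_{E',ℓ}(σ_q)` then there is no non-zero
`Γ_k`-equivariant `ℤ_ℓ`-linear `T_ℓ E → T_ℓ E'` (for `ℓ ≠ char k` a non-zero intertwiner of the
two rank-`2` lattices forces equal traces, the determinants being equal — both are `q`,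
`det_galoisRepTate_frobenius_holds`, Silverman, *AEC*, Thm. V.2.3.1 with the Weil pairing;
`trace_galoisRepTate_eq_of_exists_intertwiner_ne_zero`, Tate's Thm. 1 (b) ⇒ (c) for elliptic
curves), so the named fact `mem_span_range_tateModule_map_of_equivariant_of_finite W W' ℓ` holds
with nothing to prove. [cite: Tate1966Endomorphisms, Thm. 1 ((b) ⇒ (c))] -/
theorem mem_span_range_tateModule_map_of_equivariant_of_finite_of_trace_frobenius_ne
    [Finite K] [W.IsElliptic] [W'.IsElliptic] {σ : Field.absoluteGaloisGroup K}
    (hσ : ∀ x : AlgebraicClosure K, σ • x = x ^ Nat.card K)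
    (hne : LinearMap.trace ℤ_[ℓ] (W.tateModule ℓ) (W.galoisRepTate ℓ σ) ≠
      LinearMap.trace ℤ_[ℓ] (W'.tateModule ℓ) (W'.galoisRepTate ℓ σ)) :
    mem_span_range_tateModule_map_of_equivariant_of_finite W W' ℓ := by
  refine mem_span_range_tateModule_map_of_equivariant_of_finite_of_forall_eq_zero W W' ℓ ?_
  intro _ _ _ hℓ f hf
  by_contra hf0
  refine hne (trace_galoisRepTate_eq_of_exists_intertwiner_ne_zero hℓ σ ?_ ⟨f, hf0, hf σ⟩)
  rw [det_galoisRepTate_frobenius_holds W ℓ hℓ σ hσ, det_galoisRepTate_frobenius_holds W' ℓ hℓ σ hσ]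

/-- **Tate's theorem holds, vacuously, for two elliptic curves over a finite field with different
numbers of rational points**, granted the trace of Frobenius `tr ρ_{E,ℓ}(σ_q) = q + 1 - #E(k)` for
both curves (`htr, htr'`: the named facts `trace_galoisRepTate_frobenius` of
`FrobeniusTateModule`; Silverman, *AEC*, Thm. V.2.3.1): `#E(k) ≠ #E'(k)` gives distinct traces,
hence `Hom_Γ(T_ℓ E, T_ℓ E') = 0` (`…_of_trace_frobenius_ne`;
`card_point_eq_of_exists_tateModule_hom_ne_zero_of`). With `…_of_isIsogenous`, what remains of
the named fact `mem_span_range_tateModule_map_of_equivariant_of_finite W W' ℓ` is the case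
`#E(k) = #E'(k)`, i.e. the isogeny theorem in point-count form (Tate 1966, Thm. 1 (c) ⇒ (a);
Silverman, *AEC*, Exercise 5.4(b)). [cite: Tate1966Endomorphisms, Thm. 1 ((b) ⇒ (c))] -/
theorem mem_span_range_tateModule_map_of_equivariant_of_finite_of_card_point_ne
    (htr : W.trace_galoisRepTate_frobenius ℓ) (htr' : W'.trace_galoisRepTate_frobenius ℓ)
    (hne : Nat.card W.toAffine.Point ≠ Nat.card W'.toAffine.Point) :
    mem_span_range_tateModule_map_of_equivariant_of_finite W W' ℓ := by
  refine mem_span_range_tateModule_map_of_equivariant_of_finite_of_forall_eq_zero W W' ℓ ?_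
  intro _ _ _ hℓ f hf
  by_contra hf0
  exact hne (card_point_eq_of_exists_tateModule_hom_ne_zero_of htr
    (det_galoisRepTate_frobenius_holds W ℓ) htr' (det_galoisRepTate_frobenius_holds W' ℓ) hℓ
    ⟨f, hf0, hf⟩)

/-- The same with the traces of Frobenius supplied along Silverman's proof of Thm. V.2.3.1 from
Prop. III.8.6 (`det T_ℓ(ψ) = deg ψ`, the named facts `Isogeny.det_tateModule_map_eq_deg`), its
other inputs (Weil pairing, Thm. III.4.10(a), Cor. III.5.5) being theorems of the tree
(`trace_galoisRepTate_frobenius_of_det_tateModule_map_eq_deg`).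
[cite: SilvermanAEC2009, Thm. V.2.3.1 (proof)] -/
theorem mem_span_range_tateModule_map_of_equivariant_of_finite_of_card_point_ne_of_deg
    (h86 : Isogeny.det_tateModule_map_eq_deg W ℓ) (h86' : Isogeny.det_tateModule_map_eq_deg W' ℓ)
    (hne : Nat.card W.toAffine.Point ≠ Nat.card W'.toAffine.Point) :
    mem_span_range_tateModule_map_of_equivariant_of_finite W W' ℓ :=
  mem_span_range_tateModule_map_of_equivariant_of_finite_of_card_point_ne W W' ℓ
    (trace_galoisRepTate_frobenius_of_det_tateModule_map_eq_deg W ℓ h86)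
    (trace_galoisRepTate_frobenius_of_det_tateModule_map_eq_deg W' ℓ h86') hne

/-! ## The point-count form of what remains -/

/-- **Tate's theorem for a pair of elliptic curves over a finite field, from the isogeny theorem
in point-count form.** The named fact `mem_span_range_tateModule_map_of_equivariant_of_finite
W W' ℓ` follows from the point-count isogeny theorem for the pair (`hcard`, the named fact
`isIsogenous_iff_card_point_eq W W'`: `E ~_k E'` iff `#E(k) = #E'(k)`, Tate 1966, Thm. 1 (c);
only `←` is used) together with the trace of Frobenius for both curves (Thm. V.2.3.1, the named
facts `trace_galoisRepTate_frobenius`): either the point counts differ (`…_of_card_point_ne`) or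
the curves are isogenous (`…_of_isIsogenous`, proved in the tree).
[cite: Tate1966Endomorphisms, Main Theorem and Thm. 1(c)] -/
theorem mem_span_range_tateModule_map_of_equivariant_of_finite_of_card_point_form
    (hcard : isIsogenous_iff_card_point_eq W W')
    (htr : W.trace_galoisRepTate_frobenius ℓ) (htr' : W'.trace_galoisRepTate_frobenius ℓ) :
    mem_span_range_tateModule_map_of_equivariant_of_finite W W' ℓ := by
  intro _ _ _ hℓ f hf
  by_cases hc : Nat.card W.toAffine.Point = Nat.card W'.toAffine.Point
  · exact mem_span_range_tateModule_map_of_equivariant_of_finite_of_isIsogenous (W := W) (W' := W')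
      ℓ (hcard.mpr hc) hℓ f hf
  · exact mem_span_range_tateModule_map_of_equivariant_of_finite_of_card_point_ne W W' ℓ htr htr'
      hc hℓ f hf

/-- **Given the trace of Frobenius, Tate's Main Theorem for `(E, E')` at a prime `ℓ ≠ char k` is
equivalent to the isogeny theorem in point-count form for `(E, E')`**: the named fact
`mem_span_range_tateModule_map_of_equivariant_of_finite W W' ℓ` holds iff
`isIsogenous_iff_card_point_eq W W'` (`E ~_k E'` iff `#E(k) = #E'(k)`; Tate 1966, Thm. 1;
Silverman, *AEC*, Exercise 5.4) — forward by the tree's `isIsogenous_iff_card_point_eq_of_tate`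
(with `det ρ(σ_q) = q` proved, `det_galoisRepTate_frobenius_holds`), backward by
`…_of_card_point_form`. The hypothesis `(ℓ : K) ≠ 0` is needed for `→` only (for `ℓ = char k`
the left side is vacuous). [cite: Tate1966Endomorphisms, Main Theorem and Thm. 1] -/
theorem mem_span_range_tateModule_map_of_equivariant_of_finite_iff_card_point_form
    (hℓ : (ℓ : K) ≠ 0)
    (htr : W.trace_galoisRepTate_frobenius ℓ) (htr' : W'.trace_galoisRepTate_frobenius ℓ) :
    mem_span_range_tateModule_map_of_equivariant_of_finite W W' ℓ ↔
      isIsogenous_iff_card_point_eq W W' :=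
  ⟨fun hT ↦ isIsogenous_iff_card_point_eq_of_tate (W := W) (W' := W') (ℓ := ℓ) hℓ hT htr
      (det_galoisRepTate_frobenius_holds W ℓ) htr' (det_galoisRepTate_frobenius_holds W' ℓ),
    fun hcard ↦ mem_span_range_tateModule_map_of_equivariant_of_finite_of_card_point_form W W' ℓ
      hcard htr htr'⟩

/-- The same equivalence with the traces of Frobenius supplied from Prop. III.8.6
(`Isogeny.det_tateModule_map_eq_deg`, via `trace_galoisRepTate_frobenius_of_det_tateModule_map_eq_deg`).
[cite: Tate1966Endomorphisms, Main Theorem and Thm. 1] -/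
theorem mem_span_range_tateModule_map_of_equivariant_of_finite_iff_card_point_form_of_deg
    (hℓ : (ℓ : K) ≠ 0)
    (h86 : Isogeny.det_tateModule_map_eq_deg W ℓ) (h86' : Isogeny.det_tateModule_map_eq_deg W' ℓ) :
    mem_span_range_tateModule_map_of_equivariant_of_finite W W' ℓ ↔
      isIsogenous_iff_card_point_eq W W' :=
  mem_span_range_tateModule_map_of_equivariant_of_finite_iff_card_point_form W W' ℓ hℓ
    (trace_galoisRepTate_frobenius_of_det_tateModule_map_eq_deg W ℓ h86)
    (trace_galoisRepTate_frobenius_of_det_tateModule_map_eq_deg W' ℓ h86')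

end Literature.AlgebraicGeometry.Motives
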